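import Summits.ValiantsHypothesis.ValiantsHypothesis.Theses.SuccinctLift

/-!
# Line `char2`, stub T4 = `SmolenskyBeatsLog3` (stmt 26306) — PROOF

Elementary asymptotics: for every `c` an odd `k` and `ℓ ≥ 1` with `64 ℓ^{2(2Δ₁(m)+3)} ≤ k` and
`8((2(m^c+c)+3)^{2Δ₁(m)+2} + m²) < 2^ℓ` for all `m ≤ (k+2)²`.  Witness: `t = c + 5`, `T = 2^t`,
`N = 2^T`, `k = 2^N - 1`, `u = T - t - 4`, `ℓ = 2^(2^u)`.
-/

namespace Summit.ValiantsHypothesis.ValiantsHypothesis.Theorems.SuccinctLiftCharTwo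
open Summit.ValiantsHypothesis.ValiantsHypothesis.Theses.SuccinctLift
/-! ### arithmetic helpers -/

/-- Helper `two_pow_add_two_pow_le` of the char-2 line (see the module docstring). -/
theorem two_pow_add_two_pow_le (u v : ℕ) : 2 ^ u + 2 ^ v ≤ 2 ^ (u + v + 1) := by
  have hu : 2 ^ u ≤ 2 ^ (u + v) := Nat.pow_le_pow_right (by norm_num) (by omega)
  have hv : 2 ^ v ≤ 2 ^ (u + v) := Nat.pow_le_pow_right (by norm_num) (by omega)
  rw [pow_succ]; omega

/-- Helper `add_le_mul_two_pow` of the char-2 line (see the module docstring). -/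
theorem add_le_mul_two_pow (x c : ℕ) (hx : 1 ≤ x) : x + c ≤ x * 2 ^ c := by
  have hc : c < 2 ^ c := Nat.lt_two_pow_self
  have h1 : 1 ≤ 2 ^ c := Nat.one_le_two_pow
  calc x + c ≤ x + x * (2 ^ c - 1) := by
        have : c ≤ 2 ^ c - 1 := by omega
        have : 2 ^ c - 1 ≤ x * (2 ^ c - 1) := Nat.le_mul_of_pos_left _ hx
        omega
    _ = x * 2 ^ c := by
        rw [Nat.mul_sub, mul_one]
        have : x ≤ x * 2 ^ c := Nat.le_mul_of_pos_right _ h1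
        omega

/-- Helper `four_mul_add_four_lt_two_pow` of the char-2 line (see the module docstring). -/
theorem four_mul_add_four_lt_two_pow (u : ℕ) (hu : 6 ≤ u) : 4 * u + 4 < 2 ^ u := by
  obtain ⟨w, rfl⟩ := Nat.exists_eq_add_of_le hu
  have hw : w < 2 ^ w := Nat.lt_two_pow_self
  rw [pow_add]
  norm_num
  omega

/-- Helper `two_mul_add_eight_le_two_pow` of the char-2 line (see the module docstring). -/
theorem two_mul_add_eight_le_two_pow (t : ℕ) (ht : 5 ≤ t) : 2 * t + 8 ≤ 2 ^ t := by
  obtain ⟨w, rfl⟩ := Nat.exists_eq_add_of_le ht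
  have hw : w < 2 ^ w := Nat.lt_two_pow_self
  rw [pow_add]
  norm_num
  omega

/-- Helper `four_mul_add_le_two_pow` of the char-2 line (see the module docstring). -/
theorem four_mul_add_le_two_pow (t : ℕ) (ht : 2 ≤ t) : 4 * t + 14 ≤ 2 ^ (t + 3) := by
  obtain ⟨w, rfl⟩ := Nat.exists_eq_add_of_le ht
  have hw : w < 2 ^ w := Nat.lt_two_pow_self
  rw [pow_add, pow_add]
  norm_num
  omega

/-- Helper `sq_succ_le_four_pow` of the char-2 line (see the module docstring). -/
theorem sq_succ_le_four_pow (t : ℕ) : t * t + 1 ≤ 2 ^ (2 * t) := by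
  have ht : t < 2 ^ t := Nat.lt_two_pow_self
  have h1 : t + 1 ≤ 2 ^ t := ht
  calc t * t + 1 ≤ (t + 1) * (t + 1) := by nlinarith
    _ ≤ 2 ^ t * 2 ^ t := Nat.mul_le_mul h1 h1
    _ = 2 ^ (2 * t) := by rw [← pow_add, two_mul]

/-- Helper `log2_le_of_le_pow` of the char-2 line (see the module docstring). -/
theorem log2_le_of_le_pow {m a : ℕ} (h : m ≤ 2 ^ a) : Nat.log 2 m ≤ a :=
  (Nat.log_mono_right h).trans_eq (Nat.log_pow one_lt_two a)

/-- **T4 (stmt 26306), kernel.** -/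
theorem smolenskyBeatsLog3_proof : SmolenskyBeatsLog3 := by
  intro c
  -- parameters: t = c+5, T = 2^t = T'+1, N = 2^T = N'+1, u = T-t-4, L = 2^u, k = K = 2^N-1, ℓ = 2^L
  obtain ⟨t, ht, htc⟩ : ∃ t, 5 ≤ t ∧ t = c + 5 := ⟨c + 5, by omega, rfl⟩
  have hT : 2 * t + 8 ≤ 2 ^ t := two_mul_add_eight_le_two_pow t ht
  obtain ⟨T', hT'⟩ : ∃ T', T' + 1 = 2 ^ t := ⟨2 ^ t - 1, by omega⟩
  have htT : t < T' + 1 := hT' ▸ Nat.lt_two_pow_self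
  obtain ⟨u, hu⟩ : ∃ u, u + t + 3 = T' := ⟨T' - t - 3, by omega⟩
  have hu6 : 6 ≤ u := by omega
  have huL : 4 * u + 4 < 2 ^ u := four_mul_add_four_lt_two_pow u hu6
  have hTL : T' + 1 + 2 * t + 4 < 2 ^ u := by omega
  obtain ⟨N', hN'⟩ : ∃ N', N' + 1 = 2 ^ (T' + 1) := ⟨2 ^ (T' + 1) - 1, by
    have := @Nat.one_le_two_pow (T' + 1); omega⟩
  have hNT : T' + 1 < N' + 1 := hN' ▸ Nat.lt_two_pow_self
  obtain ⟨K, hK⟩ : ∃ K, K + 1 = 2 ^ (N' + 1) := ⟨2 ^ (N' + 1) - 1, by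
    have := @Nat.one_le_two_pow (N' + 1); omega⟩
  have hKodd : Odd K := ⟨2 ^ N' - 1, by
    have h1 : 1 ≤ 2 ^ N' := Nat.one_le_two_pow
    have h2 : 2 ^ (N' + 1) = 2 * 2 ^ N' := by rw [pow_succ]; ring
    omega⟩
  have hKeq : 2 ^ 2 ^ 2 ^ t - 1 = K := by rw [← hT', ← hN']; omega
  refine ⟨2 ^ 2 ^ 2 ^ t - 1, hKeq ▸ hKodd, 2 ^ 2 ^ u, Nat.one_le_two_pow, fun m hm => ?_⟩
  rw [hKeq] at hm ⊢
  -- m ≤ 2^(2N+2) where N = N'+1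
  have hm' : m ≤ 2 ^ (2 * (N' + 1) + 2) := by
    have h1 : K + 2 ≤ 2 ^ (N' + 1 + 1) := by rw [pow_succ, ← hK]; omega
    calc m ≤ (K + 2) ^ 2 := hm
      _ ≤ (2 ^ (N' + 1 + 1)) ^ 2 := Nat.pow_le_pow_left h1 2
      _ = 2 ^ (2 * (N' + 1) + 2) := by rw [← pow_mul]; ring_nf
  -- the triple logarithm of m is at most t + 1
  have hlog1 : Nat.log 2 m ≤ 2 * (N' + 1) + 2 := log2_le_of_le_pow hm'
  have hlog2 : Nat.log 2 (Nat.log 2 m) ≤ T' + 1 + 2 := by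
    apply log2_le_of_le_pow
    calc Nat.log 2 m ≤ 2 * (N' + 1) + 2 := hlog1
      _ ≤ 4 * (N' + 1) := by omega
      _ = 2 ^ (T' + 1 + 2) := by rw [pow_add, ← hN']; norm_num; ring
  have hlog3 : Nat.log 2 (Nat.log 2 (Nat.log 2 m)) ≤ t + 1 := by
    apply log2_le_of_le_pow
    calc Nat.log 2 (Nat.log 2 m) ≤ T' + 1 + 2 := hlog2
      _ ≤ 2 * (T' + 1) := by omega
      _ = 2 ^ (t + 1) := by rw [pow_succ, ← hT']; ring
  set D := Nat.log 2 (Nat.log 2 (Nat.log 2 m)) with hDdef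
  have he1 : 2 * (2 * (D + 1) + 2 + 1) ≤ 4 * t + 14 := by omega
  have he2 : 2 * (D + 1) + 2 ≤ 2 * t + 6 := by omega
  constructor
  · -- 64 * ℓ^{e1} ≤ k
    set L := 2 ^ u with hLdef
    have step1 : ((2 - 1) * 2 ^ L) ^ (2 * (2 * (D + 1) + 2 + 1)) ≤ 2 ^ (L * (4 * t + 14)) := by
      rw [show (2 - 1) * 2 ^ L = 2 ^ L by norm_num, ← pow_mul]
      exact Nat.pow_le_pow_right (by norm_num) (Nat.mul_le_mul_left _ he1)
    have step2 : L * (4 * t + 14) ≤ 2 ^ T' := by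
      calc L * (4 * t + 14) ≤ L * 2 ^ (t + 3) :=
            Nat.mul_le_mul_left _ (four_mul_add_le_two_pow t (by omega))
        _ = 2 ^ (u + (t + 3)) := by rw [hLdef, ← pow_add]
        _ = 2 ^ T' := by rw [← hu, Nat.add_assoc]
    have step3 : 8 ≤ 2 ^ T' := by
      calc (8 : ℕ) = 2 ^ 3 := by norm_num
        _ ≤ 2 ^ T' := Nat.pow_le_pow_right (by norm_num) (by omega)
    have hTsplit : 2 ^ (T' + 1) = 2 * 2 ^ T' := by rw [pow_succ]; ring
    have step4 : 6 + L * (4 * t + 14) ≤ N' := by omega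
    have hNsplit : 2 ^ (N' + 1) = 2 * 2 ^ N' := by rw [pow_succ]; ring
    have hN'1 : 1 ≤ 2 ^ N' := Nat.one_le_two_pow
    calc 64 * ((2 - 1) * 2 ^ L) ^ (2 * (2 * (D + 1) + 2 + 1))
        ≤ 64 * 2 ^ (L * (4 * t + 14)) := Nat.mul_le_mul_left _ step1
      _ = 2 ^ (6 + L * (4 * t + 14)) := by rw [pow_add]; norm_num
      _ ≤ 2 ^ N' := Nat.pow_le_pow_right (by norm_num) step4
      _ ≤ K := by omega
  · -- 8 * (A^{e2} + m²) < 2^ℓ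
    set a := 2 * (N' + 1) + 2 with hadef
    have hmc : m ^ c ≤ 2 ^ (a * c) := by
      rw [pow_mul]; exact Nat.pow_le_pow_left hm' c
    have hx : m ^ c + c ≤ 2 ^ (a * c + c) := by
      calc m ^ c + c ≤ 2 ^ (a * c) + c := by omega
        _ ≤ 2 ^ (a * c) * 2 ^ c := add_le_mul_two_pow _ c Nat.one_le_two_pow
        _ = 2 ^ (a * c + c) := by rw [← pow_add]
    have hA : 2 * (m ^ c + c) + 3 ≤ 2 ^ (a * c + c + 3) := by
      have h1 : 1 ≤ 2 ^ (a * c + c) := Nat.one_le_two_pow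
      rw [pow_add]; norm_num; omega
    have hA1 : 1 ≤ 2 * (m ^ c + c) + 3 := by omega
    set B := a * c + c + 3 with hBdef
    have hAe : (2 * (m ^ c + c) + 3) ^ (2 * (D + 1) + 2) ≤ 2 ^ (B * (2 * t + 6)) := by
      calc (2 * (m ^ c + c) + 3) ^ (2 * (D + 1) + 2)
          ≤ (2 * (m ^ c + c) + 3) ^ (2 * t + 6) := Nat.pow_le_pow_right hA1 he2
        _ ≤ (2 ^ B) ^ (2 * t + 6) := Nat.pow_le_pow_left hA _
        _ = 2 ^ (B * (2 * t + 6)) := by rw [← pow_mul]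
    have hmm : m * m ≤ 2 ^ (2 * a) := by
      calc m * m ≤ 2 ^ a * 2 ^ a := Nat.mul_le_mul hm' hm'
        _ = 2 ^ (2 * a) := by rw [← pow_add, two_mul]
    have hsum : (2 * (m ^ c + c) + 3) ^ (2 * (D + 1) + 2) + m * m ≤
        2 ^ (B * (2 * t + 6) + 2 * a + 1) := by
      calc (2 * (m ^ c + c) + 3) ^ (2 * (D + 1) + 2) + m * m
          ≤ 2 ^ (B * (2 * t + 6)) + 2 ^ (2 * a) := Nat.add_le_add hAe hmm
        _ ≤ 2 ^ (B * (2 * t + 6) + 2 * a + 1) := two_pow_add_two_pow_le _ _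
    have h8 : 8 * ((2 * (m ^ c + c) + 3) ^ (2 * (D + 1) + 2) + m * m) ≤
        2 ^ (B * (2 * t + 6) + 2 * a + 4) := by
      calc 8 * ((2 * (m ^ c + c) + 3) ^ (2 * (D + 1) + 2) + m * m)
          ≤ 8 * 2 ^ (B * (2 * t + 6) + 2 * a + 1) := Nat.mul_le_mul_left _ hsum
        _ = 2 ^ (B * (2 * t + 6) + 2 * a + 4) := by
          rw [show B * (2 * t + 6) + 2 * a + 4 = (B * (2 * t + 6) + 2 * a + 1) + 3 by omega,
            pow_add _ _ 3]
          ring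
    -- E ≤ 16 N (t² + 1) ≤ 2^(T + 2t + 4) and T + 2t + 4 < 2^u
    have hct : c + 1 ≤ t := by omega
    have hB : B ≤ 4 * (N' + 1) * (c + 1) := by
      have h1 : a * c ≤ 4 * (N' + 1) * c := Nat.mul_le_mul_right _ (by omega)
      have h2 : c + 3 ≤ 4 * (N' + 1) := by omega
      calc B = a * c + c + 3 := hBdef
        _ ≤ 4 * (N' + 1) * c + 4 * (N' + 1) := by omega
        _ = 4 * (N' + 1) * (c + 1) := by ring
    have h12 : B * (2 * t + 6) ≤ 16 * ((N' + 1) * (t * t)) := by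
      have h26 : 2 * t + 6 ≤ 4 * t := by omega
      calc B * (2 * t + 6) ≤ 4 * (N' + 1) * (c + 1) * (4 * t) := Nat.mul_le_mul hB h26
        _ ≤ 4 * (N' + 1) * t * (4 * t) := by gcongr
        _ = 16 * ((N' + 1) * (t * t)) := by ring
    have h4 : 2 * a + 4 ≤ 16 * (N' + 1) := by omega
    have hE : B * (2 * t + 6) + 2 * a + 4 ≤ 16 * (N' + 1) * (t * t + 1) := by
      have : 16 * (N' + 1) * (t * t + 1) = 16 * ((N' + 1) * (t * t)) + 16 * (N' + 1) := by ring
      rw [this]; omega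
    have hE2 : 16 * (N' + 1) * (t * t + 1) ≤ 2 ^ (T' + 1 + 2 * t + 4) := by
      calc 16 * (N' + 1) * (t * t + 1) ≤ 16 * (N' + 1) * 2 ^ (2 * t) :=
            Nat.mul_le_mul_left _ (sq_succ_le_four_pow t)
        _ = 2 ^ 4 * 2 ^ (T' + 1) * 2 ^ (2 * t) := by rw [hN']; norm_num
        _ = 2 ^ (T' + 1 + 2 * t + 4) := by rw [← pow_add, ← pow_add]; ring_nf
    calc 8 * ((2 * (m ^ c + c) + 3) ^ (2 * (D + 1) + 2) + m * m)
        ≤ 2 ^ (B * (2 * t + 6) + 2 * a + 4) := h8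
      _ ≤ 2 ^ (16 * (N' + 1) * (t * t + 1)) := Nat.pow_le_pow_right (by norm_num) hE
      _ ≤ 2 ^ (2 ^ (T' + 1 + 2 * t + 4)) := Nat.pow_le_pow_right (by norm_num) hE2
      _ < 2 ^ (2 ^ (2 ^ u)) := by
          apply Nat.pow_lt_pow_right (by norm_num)
          exact Nat.pow_lt_pow_right (by norm_num) hTL

end Summit.ValiantsHypothesis.ValiantsHypothesis.Theorems.SuccinctLiftCharTwo
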